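import Mathlib

/-!
# Negative-side plumbing (crux `CornerLineDescent`, stmt-CriticalPhenomena-10964; line `symmetric-seed-second-order`):
# marginality at ONE density versus the conclusion of `stub_SummedInfluence`

The line's load-bearing stub asserts, for every conformal rectangle `R`, constants `θ, c₀ > 0`, `C` with,
eventually as `δ → 0⁺`, `InfluenceBoundOn R θ C c₀ δ`, i.e.
`∀ p, c₀ δ ≤ p → p ≤ p_IK → influenceSum p R δ ≤ C p⁻¹ (δ/p)^θ` — an UNSIGNED Russo sum that must vanish
like `δ^θ` at every fixed density.  This file records the formal dichotomy behind the refuter's exact-exponent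
audit of that stub (`Cruxes/CornerLineDescent/NegativeStubSummedInfluence.md`, v3): over an arbitrary functional
`S p R δ` (instantiate `S := influenceSum`, `q := pIK`, unfold `InfluenceBoundOn`; the statements are then literally
about the stub's conclusion), MARGINALITY at a single density `p₀ ∈ (0, q]` for a single `R` — `S p₀ R δ ≥ c > 0`
along some sequence `δ → 0⁺` — refutes the conclusion, and conversely the conclusion forces `S p₀ R δ → 0` at every
density.  STATUS OF THE HYPOTHESIS (audit v3, which RETRACTS v1/v2): for the line's D₄(f)-invariant seed `κ_f` NO
marginality is found — the exactly marginal four-leg channel (`V_{(±1,2)}`, x = 2, rigid-rotation memory exponent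
3/4) is D₄-odd and cancels against the D₄-scalar local response, the leading open bulk channel being the six-leg
`V_{(0,3)}` at x = 35/12 > 2 (numerics, centre of `2n × n` boxes at `t = 1`: `n² I_f → 0`, x_eff ≈ 3–3.5 up to n = 32) —
whereas a T-even seed that is NOT D₄(f)-invariant IS marginal (control numerics: horizontal/vertical domino parities give
`n² I = −0.43 / +0.42`, flat for n = 4…16, opposite signs = the spin-2 signature).  So this lemma is the kernel-checked form of "the stub lives or dies with non-marginality", with
the percolation content on either side left as hypotheses; no percolation enters the proofs.
-/

namespace Summit.CriticalPhenomena.CardyFormulaZ2.Theorems.CornerLineDescent.Negative.SummedInfluenceMarginal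

open Filter Topology

variable {X : Type*}

/-- Marginality at a single density would refute the conclusion of `stub_SummedInfluence` (abstract shape, `S` for
`influenceSum`, `q` for `pIK`): if for some `R`, some `p₀ ∈ (0, q]` and some `c > 0` one has `c ≤ S p₀ R δ` frequently
as `δ → 0⁺`, then it is false that every `R` admits `θ, c₀ > 0`, `C` with, eventually in `δ`,
`∀ p ∈ [c₀ δ, q], S p R δ ≤ C p⁻¹ (δ/p)^θ`.  Proof: the bound at `p₀` tends to `0` (`θ > 0`) while `c₀ δ ≤ p₀`
eventually.  (Audit v3: the hypothesis is NOT expected for the D₄(f)-invariant corner seed; it is for non-D₄ seeds.) [folklore] -/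
theorem not_influenceBound_of_marginal (S : ℝ → X → ℝ → ℝ) (q : ℝ)
    (hM : ∃ (R : X) (p₀ c : ℝ), 0 < p₀ ∧ p₀ ≤ q ∧ 0 < c ∧ ∃ᶠ δ in 𝓝[>] (0:ℝ), c ≤ S p₀ R δ) :
    ¬ ∀ R : X, ∃ θ C c₀ : ℝ, 0 < θ ∧ 0 < c₀ ∧ ∀ᶠ δ in 𝓝[>] (0:ℝ),
        ∀ p : ℝ, c₀ * δ ≤ p → p ≤ q → S p R δ ≤ C * p⁻¹ * (δ / p) ^ θ := by
  intro h
  obtain ⟨R, p₀, c, hp₀, hpq, hc, hfreq⟩ := hM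
  obtain ⟨θ, C, c₀, hθ, -, hev⟩ := h R
  -- eventually the window reaches down to `p₀`
  have h1 : ∀ᶠ δ in 𝓝[>] (0:ℝ), c₀ * δ ≤ p₀ := by
    have h0 : Tendsto (fun δ : ℝ => c₀ * δ) (𝓝 (0:ℝ)) (𝓝 (c₀ * 0)) :=
      tendsto_const_nhds.mul tendsto_id
    rw [mul_zero] at h0
    exact (h0.mono_left nhdsWithin_le_nhds).eventually_le_const hp₀
  -- eventually the claimed bound at `p₀` is below `c / 2`
  have h2 : ∀ᶠ δ in 𝓝[>] (0:ℝ), C * p₀⁻¹ * (δ / p₀) ^ θ ≤ c / 2 := by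
    have hf : Tendsto (fun δ : ℝ => δ / p₀) (𝓝 (0:ℝ)) (𝓝 0) := by
      simpa using (tendsto_id.div_const p₀ : Tendsto (fun δ : ℝ => δ / p₀) (𝓝 (0:ℝ)) (𝓝 (0 / p₀)))
    have hg : Tendsto (fun x : ℝ => x ^ θ) (𝓝 (0:ℝ)) (𝓝 0) := by
      have hcont := (Real.continuousAt_rpow_const 0 θ (Or.inr hθ.le)).tendsto
      rwa [Real.zero_rpow hθ.ne'] at hcont
    have hr : Tendsto (fun δ : ℝ => (δ / p₀) ^ θ) (𝓝[>] (0:ℝ)) (𝓝 0) :=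
      (hg.comp hf).mono_left nhdsWithin_le_nhds
    have ht : Tendsto (fun δ : ℝ => C * p₀⁻¹ * (δ / p₀) ^ θ) (𝓝[>] (0:ℝ)) (𝓝 0) := by
      simpa using hr.const_mul (C * p₀⁻¹)
    exact ht.eventually_le_const (half_pos hc)
  obtain ⟨δ, hδS, hB, hδ1, hδ2⟩ := (hfreq.and_eventually (hev.and (h1.and h2))).exists
  have hbound : S p₀ R δ ≤ C * p₀⁻¹ * (δ / p₀) ^ θ := hB p₀ hδ1 hpq
  linarith

/-- Contrapositive packaging for the lead: the conclusion of `stub_SummedInfluence` (abstract shape) forces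
NON-marginality at every density `p₀ ∈ (0, q]` and every `R`: `S p₀ R δ < c` eventually for every `c > 0`, i.e.
`S p₀ R δ → 0` as `δ → 0⁺` — the first numerical milestone any proof of the stub must be consistent with
(audit v3/v4 numerics: the plaquette seed's `n² I_f` falls from 0.070 (n = 2) to ≤ 0.003 (n ≥ 24), consistent). [folklore] -/
theorem eventually_lt_of_influenceBound (S : ℝ → X → ℝ → ℝ) (q : ℝ)
    (h : ∀ R : X, ∃ θ C c₀ : ℝ, 0 < θ ∧ 0 < c₀ ∧ ∀ᶠ δ in 𝓝[>] (0:ℝ),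
        ∀ p : ℝ, c₀ * δ ≤ p → p ≤ q → S p R δ ≤ C * p⁻¹ * (δ / p) ^ θ)
    (R : X) (p₀ : ℝ) (hp₀ : 0 < p₀) (hpq : p₀ ≤ q) (c : ℝ) (hc : 0 < c) :
    ∀ᶠ δ in 𝓝[>] (0:ℝ), S p₀ R δ < c := by
  by_contra hnot
  have hfreq : ∃ᶠ δ in 𝓝[>] (0:ℝ), c ≤ S p₀ R δ := by
    simpa [not_eventually, not_lt] using hnot
  exact not_influenceBound_of_marginal S q ⟨R, p₀, c, hp₀, hpq, hc, hfreq⟩ h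

end Summit.CriticalPhenomena.CardyFormulaZ2.Theorems.CornerLineDescent.Negative.SummedInfluenceMarginal
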